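import Summits.QuantumFields.YangMills.Theorems.BalabanLadderUVSeamRecCeilingsDLRPeelingWindowCellLawsLinear
import Summits.QuantumFields.YangMills.Theorems.BalabanLadderUVSeamRecCeilingsDLRPeelingAnyCollarGlue
import HarnessLib

/-!
# Crux `UVSeamRec` (stmt-QuantumFields-20043), v5(α) stub `stub_responseMomentsOdd6` (RM), lane B: the (RM) press-buttons and the v7-shaped glue of
# the WINDOW-CELL-LAW currency with a LINEAR large-field budget — summability clause `Σ_{1≤k≤kmax β R} δ β k ≤ D` (no sixteenth roots)

Helper file (`--supports stmt-QuantumFields-20043`) of the width-lever seat `ym-20043-ceilings-p2` (lane B, gen 8); sequel of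
`…CeilingsDLRPeelingWindowCellLawsLinear` (doubled moments of the influence functionals from window cell laws with the budget
`(6144 + 2(e−1)·1536·(δ₀ + Σ_{1≤k≤kmax} δ_k))·#T`), the linear twin of g3's `…CeilingsWindowCellLaws` §3/`…WindowCellLawsGlueV6` (p554392/p555649;
level weights `θ_k` with `δ_k ≤ θ_k^{16}` and budget `2e²·1536·(Δ₀ + Σ θ_k)`).

* `responseMoments_of_quadratic_and_windowCellLaws_linear` — (split) + (EM_Q) + eventual level-`0` bound `Δ₀` + window cell laws at the levels `k ≥ 1`
  (activities `δ β k ≥ 0`, budget `Σ_{1≤k≤kmax β R} δ β k ≤ D`) ⇒ (RM) on ALL separated families of ALL odd tori,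
  `B = A₀ + max(B_Q, 6144 + 2(e−1)·1536·(Δ₀ + D))`, fundamental `SU(N)`;
* `responseMomentsOdd6_of_quadratic_and_windowCellLaws_linear` — the registered `SU(2)` twin;
* `responseMomentsOdd6SU2_of_splitCl_gaussianDomination_windowCellLaws_linear` — THE v7-SHAPED GLUE with the linear budget: `SplitCl` +
  `GaussianDominationSU2` + floor `0 < ε₀ ≤ ε β 0` + window cell laws (`k ≥ 1`) + `Σ_{1≤k≤kmax β R} δ β k ≤ D` ⇒ `ResponseMomentsDefs.ResponseMomentsOdd6SU2`.
So a v7 along (β-cl) may register `stub_backgroundFieldWCL` with the activities themselves summable (no `θ`, no `δ ≤ θ^16`) and close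
`stub_responseMomentsOdd6` by `exact` the third theorem; the far-UV supplier `PolymerRarity.windowCellLaws_summable_farUV` (p566822) already delivers
`Σ δ^{1/16} ≤ 1`, a fortiori `Σ δ ≤ 1`.

HONEST FRAMING.  Composition of OPEN renormalisation-group inputs ((split-cl), (GD), window cell laws at `k ≥ 1` — Bałaban-type large-field estimates one
scale at a time on every odd torus); nothing of E0′; not a gap, not Clay.  References: folklore.
-/


set_option autoImplicit false

noncomputable section

open MeasureTheory Filter Topology Finset
open Literature.Probability.LatticeModels
open Literature.MathematicalPhysics.QuantumFieldTheory (GaugeConfig LatticeRep)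
open Literature.MathematicalPhysics.QuantumLattice
open Summit.QuantumFields.YangMills.Cruxes.OSLegsFromFemtoAndGap.DlrCollarTransfer
open Summit.QuantumFields.YangMills.Cruxes.UVSeamRec.ClassicalResponse
open Summit.QuantumFields.YangMills.Cruxes.UVSeamRec.PolymerData
open Summit.QuantumFields.YangMills.Cruxes.UVSeamRec.TemperedResponse
open Summit.QuantumFields.YangMills.Theorems.OddTorusChessboard (Orient)

namespace Summit.QuantumFields.YangMills.Cruxes.UVSeamRec.DLRPeeling

/-! ## §1 (RM) on ALL families of ALL odd tori from (split) + (EM_Q) + window cell laws, linear budget -/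

section Button

variable {N : ℕ} [NeZero N]

/-- **(RM) FROM THE (β) SPLIT, (EM_Q) AND WINDOW CELL LAWS AT THE LEVELS `k ≥ 1`, LINEAR BUDGET.**  Fundamental representation of `SU(N)`, any unit
`a`; block size `𝔟`, thresholds `ε β k`, cutoff `kmax β R`.  Hypotheses: (split) for all exteriors against `A₀ + Q + influenceAt 𝔟 ε kmax`; (EM_Q); the
eventual bound `Δ₀` of the PROVED level-`0` activity; activities `δ β k ≥ 0` with the WINDOW CELL LAWS for `β ≥ β₁`, `L ≥ 1`, `k ≥ 1` (families of
level-`k` block-plaquettes whose blocks fit in one period window); and the PLAIN budget `Σ_{1 ≤ k ≤ kmax β R} δ β k ≤ D`.  THEN (RM) for `β ≥ β₁'` on ALL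
separated families of ALL odd tori with `B = A₀ + max(B_Q, 6144 + 2(e−1)·1536·(Δ₀ + D))`.  Proof: seam reduction `responseMoments_of_quadratic_and_reducedLF`
over `torusE_exp_two_mul_sum_influence_le_of_windowCellLaws_linear`.  HONEST FRAMING: composition of OPEN RG inputs; nothing of E0′. [folklore] -/
theorem responseMoments_of_quadratic_and_windowCellLaws_linear (a : ℝ → ℝ) (𝔟 : BlockSize)
    (ε : ℝ → ℕ → ℝ) (kmax : ℝ → ℕ → ℕ) {C₁ β₁ ℓ₁ A₀ B_Q D Δ₀ : ℝ} {p : Fin 4 × Fin 4 → ℝ → ℝ}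
    (Q : ℝ → ℕ → Fin 4 × Fin 4 → (Fin 4 → ℤ) → LGConfig 4 (Matrix.specialUnitaryGroup (Fin N) ℂ) → ℝ)
    (MQ : ℝ → ℕ → Fin 4 × Fin 4 → (Fin 4 → ℤ) → ℝ)
    (hQm : ∀ β R q x, Measurable (Q β R q x)) (hQb : ∀ β R q x η, |Q β R q x η| ≤ MQ β R q x)
    (hsplit : ∀ β : ℝ, β₁ ≤ β → ∀ R : ℕ, 1 ≤ R → (R : ℝ) * a β ≤ ℓ₁ →
      ∀ (q : Fin 4 × Fin 4) (x : Fin 4 → ℤ), q.1 < q.2 → ∀ η : LGConfig 4 (Matrix.specialUnitaryGroup (Fin N) ℂ),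
        (R : ℝ) ^ 4 / C₁ * |kerE (Matrix.specialUnitaryGroup (Fin N) ℂ) (fundamentalLatticeRep N) β (fun k => x k - (R + 1))
          (2 * R + 3) η (plane (Matrix.specialUnitaryGroup (Fin N) ℂ) (fundamentalLatticeRep N) q x) - p q β| ≤
          A₀ + Q β R q x η + influenceAt (N := N) 𝔟 ε kmax β R q x η)
    (hEMQ : ∀ β : ℝ, β₁ ≤ β → ∀ (L n : ℕ) (q : Fin n → Fin 4 × Fin 4) (x : Fin n → (Fin 4 → ℤ)) (R : ℕ),
      (∀ i, (q i).1 < (q i).2) → 1 ≤ R → (R : ℝ) * a β ≤ ℓ₁ → 4 * R + 8 ≤ L →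
      (∀ i j : Fin n, i ≠ j → ∃ k : Fin 4,
        (2 * (R : ℤ) + 4) ≤ |((((x i k - x j k : ℤ) : ZMod (2 * L + 1))).valMinAbs : ℤ)|) →
      ∀ T : Finset (Fin n),
        torusE (Matrix.specialUnitaryGroup (Fin N) ℂ) (fundamentalLatticeRep N) β L
          (fun U => Real.exp (((2 : ℕ) : ℝ) * ∑ i ∈ T, Q β R (q i) (x i) U)) ≤ Real.exp (B_Q * T.card))
    (hδ₀ : ∀ (K₀ : ℝ) (D₁ : ℕ), ∃ β₀ : ℝ, ∀ β : ℝ, β₀ ≤ β →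
      Real.exp (-(β * ((N : ℝ) * ε β 0)) / Fintype.card (Orient 4) + (K₀ + D₁ * Real.log β) / Fintype.card (Orient 4)) ≤ Δ₀)
    (δ : ℝ → ℕ → ℝ) (hδ0 : ∀ β k, 0 ≤ δ β k)
    (hWCL : ∀ β : ℝ, β₁ ≤ β → ∀ L : ℕ, 1 ≤ L → ∀ k : ℕ, 1 ≤ k → ∀ (o : Fin 4 → ℤ) (A : Finset Polymer),
      (∀ γ ∈ A, γ.k = k) → (∀ γ ∈ A, ∀ c, o c ≤ anchor 𝔟 γ c ∧ anchor 𝔟 γ c + (𝔟.b : ℤ) ^ k ≤ o c + (2 * L + 1)) →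
      torusE (Matrix.specialUnitaryGroup (Fin N) ℂ) (fundamentalLatticeRep N) β L (fun U => ∏ γ ∈ A,
        (largeFieldEvent (N := N) 𝔟 (ε β k) γ).indicator (fun _ => (1 : ℝ)) U) ≤ ∏ _γ ∈ A, δ β k)
    (hD : ∀ β : ℝ, β₁ ≤ β → ∀ R : ℕ, ∑ k ∈ (Finset.range (kmax β R + 1)).filter (fun k => 1 ≤ k), δ β k ≤ D) :
    ∃ β₁' : ℝ, ∀ β : ℝ, β₁' ≤ β → ∀ (L n : ℕ) (q : Fin n → Fin 4 × Fin 4) (x : Fin n → (Fin 4 → ℤ)) (R : ℕ),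
      (∀ i, (q i).1 < (q i).2) → 1 ≤ R → (R : ℝ) * a β ≤ ℓ₁ → 4 * R + 8 ≤ L →
      (∀ i j : Fin n, i ≠ j → ∃ k : Fin 4,
        (2 * (R : ℤ) + 4) ≤ |((((x i k - x j k : ℤ) : ZMod (2 * L + 1))).valMinAbs : ℤ)|) →
      ∀ T : Finset (Fin n),
        torusE (Matrix.specialUnitaryGroup (Fin N) ℂ) (fundamentalLatticeRep N) β L (fun U => Real.exp (∑ i ∈ T, (R : ℝ) ^ 4 / C₁ *
          |kerE (Matrix.specialUnitaryGroup (Fin N) ℂ) (fundamentalLatticeRep N) β (fun k => x i k - (R + 1)) (2 * R + 3) U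
            (plane (Matrix.specialUnitaryGroup (Fin N) ℂ) (fundamentalLatticeRep N) (q i) (x i)) - p (q i) β|)) ≤
          Real.exp ((A₀ + max B_Q (6144 + 2 * (Real.exp 1 - 1) * 1536 * (Δ₀ + D))) * T.card) := by
  classical
  obtain ⟨K₀, D₁, hLF⟩ := torusE_exp_two_mul_sum_influence_le_of_windowCellLaws_linear (N := N)
  obtain ⟨β₀, hβ₀⟩ := hδ₀ K₀ D₁
  refine ⟨max (max β₁ 1) β₀, ?_⟩
  refine responseMoments_of_quadratic_and_reducedLF (fundamentalLatticeRep N) a (β₁ := max (max β₁ 1) β₀)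
    Q (influenceAt (N := N) 𝔟 ε kmax) (fun β R q x => max (MQ β R q x) (coeffMass 𝔟 (kmax β R) R x)) hQm
    (fun β R q x η => (hQb β R q x η).trans (le_max_left _ _))
    (fun β R q x => measurable_influenceAt (N := N) 𝔟 ε kmax β R q x)
    (fun β R q x η => (abs_influenceAt_le (N := N) 𝔟 ε kmax β R q x η).trans (le_max_right _ _))
    (fun β hβ => hsplit β ((le_max_left _ _).trans ((le_max_left _ _).trans hβ)))
    (fun β hβ => hEMQ β ((le_max_left _ _).trans ((le_max_left _ _).trans hβ))) ?_
  intro β hβ L n q x R hq hR hRa hRL hred hsep T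
  have hβ₁ : β₁ ≤ β := (le_max_left _ _).trans ((le_max_left _ _).trans hβ)
  have hβ1 : 1 ≤ β := (le_max_right _ _).trans ((le_max_left _ _).trans hβ)
  have hββ₀ : β₀ ≤ β := (le_max_right _ _).trans hβ
  have hL : 1 ≤ L := by omega
  have h := hLF 𝔟 (ε β) (kmax β R) R L β hβ1 x hR hRL hred hsep (δ β) (hδ0 β)
    (fun k hk o A hAk hwin => hWCL β hβ₁ L hL k hk o A hAk hwin) T
  refine (le_of_eq ?_).trans (h.trans (Real.exp_le_exp.2 ?_))
  · simp only [influenceAt_eq]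
  · refine mul_le_mul_of_nonneg_right ?_ (Nat.cast_nonneg _)
    have h1 := hβ₀ β hββ₀
    have h2 := hD β hβ₁ R
    have h3 : 0 ≤ 2 * (Real.exp 1 - 1) * 1536 := by
      have := Real.add_one_le_exp (1 : ℝ); nlinarith
    have h4 := mul_le_mul_of_nonneg_left (add_le_add h1 h2) h3
    linarith

end Button

/-! ## §2 At the registered stub (SU(2), fundamental representation, unit of record) -/

section Unit

/-- **The body of `stub_responseMomentsOdd6` from the (β) split, (EM_Q), a vanishing level-`0` activity and WINDOW CELL LAWS at the levels `k ≥ 1` with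
PLAINLY summable activities.**  `SU(2)`, fundamental representation, unit `a ≤ c·uRec` eventually; conclusion = the registered body with
`B = A₀ + max(B_Q, 6144 + 2(e−1)·1536·(Δ₀ + D))`.  HONEST FRAMING: composition of OPEN RG inputs; nothing of E0′. [folklore] -/
theorem responseMomentsOdd6_of_quadratic_and_windowCellLaws_linear {a : ℝ → ℝ} {c C₁ β₁ ℓ₁ A₀ B_Q D Δ₀ P₀ : ℝ}
    {p : Fin 4 × Fin 4 → ℝ → ℝ} (hc : 0 < c) (hle : ∀ᶠ β in atTop, a β ≤ c * Transport.uRec β) (hℓ₁ : 0 < ℓ₁)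
    (hC₁ : 0 < C₁) (hp : ∀ q β, |p q β| ≤ P₀) (𝔟 : BlockSize) (ε : ℝ → ℕ → ℝ)
    (kmax : ℝ → ℕ → ℕ)
    (Q : ℝ → ℕ → Fin 4 × Fin 4 → (Fin 4 → ℤ) → LGConfig 4 (Matrix.specialUnitaryGroup (Fin 2) ℂ) → ℝ)
    (MQ : ℝ → ℕ → Fin 4 × Fin 4 → (Fin 4 → ℤ) → ℝ)
    (hQm : ∀ β R q x, Measurable (Q β R q x)) (hQb : ∀ β R q x η, |Q β R q x η| ≤ MQ β R q x)
    (hsplit : ∀ β : ℝ, β₁ ≤ β → ∀ R : ℕ, 1 ≤ R → (R : ℝ) * a β ≤ ℓ₁ →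
      ∀ (q : Fin 4 × Fin 4) (x : Fin 4 → ℤ), q.1 < q.2 → ∀ η : LGConfig 4 (Matrix.specialUnitaryGroup (Fin 2) ℂ),
        (R : ℝ) ^ 4 / C₁ * |kerE (Matrix.specialUnitaryGroup (Fin 2) ℂ) (fundamentalLatticeRep 2) β (fun k => x k - (R + 1))
          (2 * R + 3) η (plane (Matrix.specialUnitaryGroup (Fin 2) ℂ) (fundamentalLatticeRep 2) q x) - p q β| ≤
          A₀ + Q β R q x η + influenceAt (N := 2) 𝔟 ε kmax β R q x η)
    (hEMQ : ∀ β : ℝ, β₁ ≤ β → ∀ (L n : ℕ) (q : Fin n → Fin 4 × Fin 4) (x : Fin n → (Fin 4 → ℤ)) (R : ℕ),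
      (∀ i, (q i).1 < (q i).2) → 1 ≤ R → (R : ℝ) * a β ≤ ℓ₁ → 4 * R + 8 ≤ L →
      (∀ i j : Fin n, i ≠ j → ∃ k : Fin 4,
        (2 * (R : ℤ) + 4) ≤ |((((x i k - x j k : ℤ) : ZMod (2 * L + 1))).valMinAbs : ℤ)|) →
      ∀ T : Finset (Fin n),
        torusE (Matrix.specialUnitaryGroup (Fin 2) ℂ) (fundamentalLatticeRep 2) β L
          (fun U => Real.exp (((2 : ℕ) : ℝ) * ∑ i ∈ T, Q β R (q i) (x i) U)) ≤ Real.exp (B_Q * T.card))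
    (hδ₀ : ∀ (K₀ : ℝ) (D₁ : ℕ), ∃ β₀ : ℝ, ∀ β : ℝ, β₀ ≤ β →
      Real.exp (-(β * ((2 : ℕ) * ε β 0 : ℝ)) / Fintype.card (Orient 4) + (K₀ + D₁ * Real.log β) / Fintype.card (Orient 4)) ≤ Δ₀)
    (δ : ℝ → ℕ → ℝ) (hδ0 : ∀ β k, 0 ≤ δ β k)
    (hWCL : ∀ β : ℝ, β₁ ≤ β → ∀ L : ℕ, 1 ≤ L → ∀ k : ℕ, 1 ≤ k → ∀ (o : Fin 4 → ℤ) (A : Finset Polymer),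
      (∀ γ ∈ A, γ.k = k) → (∀ γ ∈ A, ∀ c, o c ≤ anchor 𝔟 γ c ∧ anchor 𝔟 γ c + (𝔟.b : ℤ) ^ k ≤ o c + (2 * L + 1)) →
      torusE (Matrix.specialUnitaryGroup (Fin 2) ℂ) (fundamentalLatticeRep 2) β L (fun U => ∏ γ ∈ A,
        (largeFieldEvent (N := 2) 𝔟 (ε β k) γ).indicator (fun _ => (1 : ℝ)) U) ≤ ∏ _γ ∈ A, δ β k)
    (hD : ∀ β : ℝ, β₁ ≤ β → ∀ R : ℕ, ∑ k ∈ (Finset.range (kmax β R + 1)).filter (fun k => 1 ≤ k), δ β k ≤ D) :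
    ∃ (a : ℝ → ℝ) (c : ℝ) (C₁ B β₁ ℓ₁ P₀ : ℝ) (p : Fin 4 × Fin 4 → ℝ → ℝ), 0 < c ∧
      (∀ᶠ β in atTop, a β ≤ c * Transport.uRec β) ∧ 0 < ℓ₁ ∧ 0 < C₁ ∧ (∀ q β, |p q β| ≤ P₀) ∧
      ∀ β : ℝ, β₁ ≤ β → ∀ (L n : ℕ) (q : Fin n → Fin 4 × Fin 4) (x : Fin n → (Fin 4 → ℤ)) (R : ℕ),
        (∀ i, (q i).1 < (q i).2) → 1 ≤ R → (R : ℝ) * a β ≤ ℓ₁ → 4 * R + 8 ≤ L →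
        (∀ i j : Fin n, i ≠ j → ∃ k : Fin 4,
          (2 * (R : ℤ) + 4) ≤ |((((x i k - x j k : ℤ) : ZMod (2 * L + 1))).valMinAbs : ℤ)|) →
        ∀ T : Finset (Fin n),
          torusE (Matrix.specialUnitaryGroup (Fin 2) ℂ) (fundamentalLatticeRep 2) β L
            (fun U => Real.exp (∑ i ∈ T, (R : ℝ) ^ 4 / C₁ *
              |kerE (Matrix.specialUnitaryGroup (Fin 2) ℂ) (fundamentalLatticeRep 2) β (fun k => x i k - (R + 1)) (2 * R + 3) U
                (plane (Matrix.specialUnitaryGroup (Fin 2) ℂ) (fundamentalLatticeRep 2) (q i) (x i)) - p (q i) β|)) ≤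
            Real.exp (B * T.card) := by
  obtain ⟨β₁', h⟩ := responseMoments_of_quadratic_and_windowCellLaws_linear (N := 2) a 𝔟 ε kmax Q MQ hQm hQb
    hsplit hEMQ (by simpa using hδ₀) δ hδ0 hWCL hD
  exact ⟨a, c, C₁, A₀ + max B_Q (6144 + 2 * (Real.exp 1 - 1) * 1536 * (Δ₀ + D)), β₁', ℓ₁, P₀, p, hc, hle, hℓ₁, hC₁, hp, h⟩

/-- **THE v7-SHAPED GLUE WITH A LINEAR LARGE-FIELD BUDGET: (split-cl) + (GD) + WINDOW CELL LAWS with PLAINLY summable activities ⇒ the registered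
stub body `ResponseMomentsOdd6SU2`.**  Tempering data `𝔟, ε, kmax`, constants `C_s > 0`, `C₁ > 0`, `A₀ ≥ 0`, `ℓ₁ > 0`, bounded reference values `p`, with
the LEAD's (split-cl) `SplitCl 𝔟 ε kmax C_s C₁ A₀ β₁ ℓ₁ p` and (GD) `GaussianDominationSU2`; a level-`0` threshold floor `0 < ε₀ ≤ ε β 0`; and the window
cell laws at the levels `k ≥ 1` with activities `δ β k ≥ 0` and the PLAIN budget `Σ_{1≤k≤kmax β R} δ β k ≤ D` (`β ≥ β₁`).  THEN `ResponseMomentsOdd6SU2`.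
Proof = g3's v6/v7 glue (p555649) with the linear-budget press-button of §1.  HONEST FRAMING: composition; all inputs are OPEN renormalisation-group
statements; nothing of E0′. [folklore] -/
theorem responseMomentsOdd6SU2_of_splitCl_gaussianDomination_windowCellLaws_linear
    (𝔟 : BlockSize) (ε : ℝ → ℕ → ℝ) (kmax : ℝ → ℕ → ℕ) {C_s C₁ A₀ P₀ β₁ ℓ₁ D ε₀ : ℝ} {p : Fin 4 × Fin 4 → ℝ → ℝ}
    (hCs : 0 < C_s) (hC₁ : 0 < C₁) (hA₀ : 0 ≤ A₀) (hℓ₁ : 0 < ℓ₁) (hp : ∀ q β, |p q β| ≤ P₀)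
    (hsplit : SplitCl 𝔟 ε kmax C_s C₁ A₀ β₁ ℓ₁ p) (hGD : GaussianDominationSU2)
    (hε₀ : 0 < ε₀) (hε : ∀ β, ε₀ ≤ ε β 0)
    (δ : ℝ → ℕ → ℝ) (hδ0 : ∀ β k, 0 ≤ δ β k)
    (hWCL : ∀ β : ℝ, β₁ ≤ β → ∀ L : ℕ, 1 ≤ L → ∀ k : ℕ, 1 ≤ k → ∀ (o : Fin 4 → ℤ) (A : Finset Polymer),
      (∀ γ ∈ A, γ.k = k) → (∀ γ ∈ A, ∀ c, o c ≤ anchor 𝔟 γ c ∧ anchor 𝔟 γ c + (𝔟.b : ℤ) ^ k ≤ o c + (2 * L + 1)) →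
      torusE (Matrix.specialUnitaryGroup (Fin 2) ℂ) (fundamentalLatticeRep 2) β L (fun U => ∏ γ ∈ A,
        (largeFieldEvent (N := 2) 𝔟 (ε β k) γ).indicator (fun _ => (1 : ℝ)) U) ≤ ∏ _γ ∈ A, δ β k)
    (hD : ∀ β : ℝ, β₁ ≤ β → ∀ R : ℕ, ∑ k ∈ (Finset.range (kmax β R + 1)).filter (fun k => 1 ≤ k), δ β k ≤ D) :
    ResponseMomentsDefs.ResponseMomentsOdd6SU2 := by
  obtain ⟨m₁, v₁, β₁', ℓ₁', hℓ₁', hEM⟩ := hGD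
  -- constants (as in the LEAD's glue)
  set C : ℝ := max C_s (4 * v₁ + 1) with hCdef
  have hCsC : C_s ≤ C := le_max_left _ _
  have hCpos : 0 < C := hCs.trans_le hCsC
  have h4v : 4 * (v₁ / C) < 1 := by
    rw [mul_div_assoc', div_lt_one hCpos]
    have : 4 * v₁ + 1 ≤ C := le_max_right _ _
    linarith
  set β₀ : ℝ := max (max β₁ β₁') 0 with hβ₀
  have hβ₀₁ : β₁ ≤ β₀ := (le_max_left _ _).trans (le_max_left _ _)
  have hβ₀₁' : β₁' ≤ β₀ := (le_max_right _ _).trans (le_max_left _ _)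
  have hβ₀0 : 0 ≤ β₀ := le_max_right _ _
  set ℓ₀ : ℝ := min ℓ₁ ℓ₁' with hℓ₀
  have hℓ₀pos : 0 < ℓ₀ := lt_min hℓ₁ hℓ₁'
  set rF : LatticeRep (Matrix.specialUnitaryGroup (Fin 2) ℂ) := fundamentalLatticeRep 2 with hrF
  -- rescaled laws
  have hsplitC := splitCl_rescale hCs hCsC hA₀ hsplit
  have hEMC := emLin_rescale hCpos hEM
  -- the quadratic carrier and its linear statistic
  set Q : ℝ → ℕ → Fin 4 × Fin 4 → (Fin 4 → ℤ) → LGConfig 4 (Matrix.specialUnitaryGroup (Fin 2) ℂ) → ℝ :=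
    fun β R q x η => carrierCl rF C 1 β R q x η with hQdef
  set ℓ : ℝ → ℕ → Fin 4 × Fin 4 → (Fin 4 → ℤ) → LGConfig 4 (Matrix.specialUnitaryGroup (Fin 2) ℂ) → ℝ :=
    fun β R q x η => Real.sqrt (carrierCl rF C 1 β R q x η) with hℓdef
  have hℓm : ∀ β R q x, Measurable (ℓ β R q x) := fun β R q x => (measurable_carrierCl (r := rF) C 1 β R q x).sqrt
  have hℓb : ∀ β R q x η, |ℓ β R q x η| ≤ Real.sqrt (|β| * (R : ℝ) ^ 4 / |C| * (2 * rF.N)) := fun β R q x η => by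
    simp only [hℓdef]
    rw [abs_of_nonneg (Real.sqrt_nonneg _)]
    exact Real.sqrt_le_sqrt ((le_abs_self _).trans (abs_carrierCl_le (r := rF) C one_pos β R q x η))
  -- (EM_Q) for `1·ℓ²` from the rescaled (EM_lin), restricted to β ≥ β₀ and R·uRec β ≤ ℓ₀
  have hEMQ1 := emQ_of_subGaussianLinear rF Transport.uRec (β₁ := β₀) (ℓ₁ := ℓ₀) ℓ
    (fun β R => Real.sqrt (|β| * (R : ℝ) ^ 4 / |C| * (2 * rF.N))) hℓm hℓb (m := m₁ / Real.sqrt C) (v := v₁ / C) (lam := 1)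
    zero_le_one (by linarith)
    (fun β hβ L n q x R hq hR hRa hL hsep T t =>
      hEMC β (hβ₀₁'.trans hβ) L n q x R hq hR (hRa.trans (min_le_right _ _)) hL hsep T t)
  -- convert `1·(√Q)²` to `Q` (β ≥ β₀ ≥ 0)
  have hEMQ : ∀ β : ℝ, β₀ ≤ β → ∀ (L n : ℕ) (q : Fin n → Fin 4 × Fin 4) (x : Fin n → (Fin 4 → ℤ)) (R : ℕ),
      (∀ i, (q i).1 < (q i).2) → 1 ≤ R → (R : ℝ) * Transport.uRec β ≤ ℓ₀ → 4 * R + 8 ≤ L →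
      (∀ i j : Fin n, i ≠ j → ∃ k : Fin 4,
        (2 * (R : ℤ) + 4) ≤ |((((x i k - x j k : ℤ) : ZMod (2 * L + 1))).valMinAbs : ℤ)|) →
      ∀ T : Finset (Fin n),
        torusE (Matrix.specialUnitaryGroup (Fin 2) ℂ) rF β L
          (fun U => Real.exp (((2 : ℕ) : ℝ) * ∑ i ∈ T, Q β R (q i) (x i) U)) ≤
          Real.exp (Real.log (2 * (Real.sqrt (1 / (1 - 4 * (1 * (v₁ / C)))) *
            Real.exp (2 * 1 * (m₁ / Real.sqrt C) ^ 2 / (1 - 4 * (1 * (v₁ / C)))))) * T.card) := by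
    intro β hβ L n q x R hq hR hRa hL hsep T
    have h := hEMQ1 β hβ L n q x R hq hR hRa hL hsep T
    have e : (fun U : LGConfig 4 (Matrix.specialUnitaryGroup (Fin 2) ℂ) =>
        Real.exp (((2 : ℕ) : ℝ) * ∑ i ∈ T, Q β R (q i) (x i) U)) =
        (fun U => Real.exp (((2 : ℕ) : ℝ) * ∑ i ∈ T, 1 * (ℓ β R (q i) (x i) U) ^ 2)) := by
      funext U
      refine congrArg Real.exp (congrArg _ (Finset.sum_congr rfl fun i _ => ?_))
      simp only [hQdef, hℓdef]
      rw [one_mul, Real.sq_sqrt (carrierCl_nonneg (r := rF) hCpos one_pos (hβ₀0.trans hβ) R (q i) (x i) U)]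
    rw [e]
    exact h
  -- (RM) body from the linear-budget window-cell-law button (threshold floor at level 0 gives the eventual bound Δ₀ := 1)
  obtain ⟨β₁'', hRM⟩ := responseMoments_of_quadratic_and_windowCellLaws_linear (N := 2) Transport.uRec 𝔟 ε kmax
    (C₁ := C₁ * C / C_s) (β₁ := β₀) (ℓ₁ := ℓ₀) (A₀ := A₀) (D := D) (Δ₀ := 1) (p := p) Q
    (fun β R _ _ => |β| * (R : ℝ) ^ 4 / |C| * (2 * rF.N))
    (fun β R q x => measurable_carrierCl (r := rF) C 1 β R q x)
    (fun β R q x η => abs_carrierCl_le (r := rF) C one_pos β R q x η)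
    (fun β hβ R hR hRa q x hq η => hsplitC β (hβ₀₁.trans hβ) R hR (hRa.trans (min_le_left _ _)) q x hq η)
    hEMQ (fun K₀ D₁ => levelZero_activity_eventually_le (N := 2) two_pos hε₀ one_pos ε hε K₀ D₁) δ hδ0
    (fun β hβ L hL k hk o A hAk hwin => hWCL β (hβ₀₁.trans hβ) L hL k hk o A hAk hwin)
    (fun β hβ R => hD β (hβ₀₁.trans hβ) R)
  exact ⟨Transport.uRec, 1, C₁ * C / C_s, _, β₁'', ℓ₀, P₀, p, one_pos,
    Filter.Eventually.of_forall fun β => by rw [one_mul], hℓ₀pos, by positivity, hp, hRM⟩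

end Unit

end Summit.QuantumFields.YangMills.Cruxes.UVSeamRec.DLRPeeling

end
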